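import Summits.Ventures.PercRepro.RankLevelSetRuleQModelMatroid
import Summits.Ventures.PercRepro.RankLevelSetCountBounds

/-!
# PercRepro — THE MODEL MATROID: COUNTING THE INDEX SETS OF EACH TYPE (night-1, gen 14; step 6 of `ModelRecvEq`)

For `Z ⊆ F ⊆ E` (finite) the sets `S` with `Z ⊆ S ⊆ E`, `#(S ∩ F) = #Z + a` and `#(S ∖ F) = j` — the index sets
`Z ∪ X_P ∪ X_D` of type `(a, j)` — number `C(#F − #Z, a)·C(#(E ∖ F), j)` (the bijection `S ↦ ((S ∩ F) ∖ Z, S ∖ F)`).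
* **`ncard_index_sets_eq`** — that count.
Axioms: standard.
-/

namespace PercRepro

open Set

variable {α : Type}

/-- **The index sets of type `(a, j)` above `Z`** number `C(#F − #Z, a)·C(#(E ∖ F), j)`. -/
theorem ncard_index_sets_eq {E F Z : Set α} (hE : E.Finite) (hF : F ⊆ E) (hZF : Z ⊆ F) (a j : ℕ) :
    {S : Set α | Z ⊆ S ∧ S ⊆ E ∧ (S ∩ F).ncard = Z.ncard + a ∧ (S \ F).ncard = j}.ncard =
      (F.ncard - Z.ncard).choose a * (E \ F).ncard.choose j := by
  classical
  have hFfin : F.Finite := hE.subset hF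
  have hZfin : Z.Finite := hFfin.subset hZF
  set P' : Finset α := (hFfin.sdiff (t := Z)).toFinset with hP'
  set D' : Finset α := (hE.sdiff (t := F)).toFinset with hD'
  have hPc : (P' : Set α) = F \ Z := Set.Finite.coe_toFinset _
  have hDc : (D' : Set α) = E \ F := Set.Finite.coe_toFinset _
  have hPcard : P'.card = F.ncard - Z.ncard := by
    rw [← Set.ncard_eq_toFinset_card (F \ Z) (hFfin.sdiff), Set.ncard_sdiff hZF hZfin]
  have hDcard : D'.card = (E \ F).ncard := (Set.ncard_eq_toFinset_card (E \ F) hE.sdiff).symm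
  set T : Set (Set α) := {S : Set α | Z ⊆ S ∧ S ⊆ E ∧ (S ∩ F).ncard = Z.ncard + a ∧ (S \ F).ncard = j} with hT
  set A : Set (Set α) := {Y : Set α | Y ⊆ (P' : Set α) ∧ Y.ncard = a} with hA
  set B : Set (Set α) := {Y : Set α | Y ⊆ (D' : Set α) ∧ Y.ncard = j} with hB
  have hAcard : A.ncard = (F.ncard - Z.ncard).choose a := by
    rw [hA, PercRepro.ncard_subsets_ncard_eq, hPcard]
  have hBcard : B.ncard = (E \ F).ncard.choose j := by
    rw [hB, PercRepro.ncard_subsets_ncard_eq, hDcard]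
  -- the map S ↦ ((S ∩ F) ∖ Z, S ∖ F)
  have hinj : Set.InjOn (fun S : Set α => ((S ∩ F) \ Z, S \ F)) T := by
    rintro S ⟨hZS, -, -, -⟩ S' ⟨hZS', -, -, -⟩ hSS'
    simp only [Prod.mk.injEq] at hSS'
    have h1 : S = Z ∪ ((S ∩ F) \ Z) ∪ (S \ F) := by
      ext x
      constructor
      · intro hx
        by_cases hxF : x ∈ F
        · by_cases hxZ : x ∈ Z
          · exact Or.inl (Or.inl hxZ)
          · exact Or.inl (Or.inr ⟨⟨hx, hxF⟩, hxZ⟩)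
        · exact Or.inr ⟨hx, hxF⟩
      · rintro ((hx | ⟨⟨hx, -⟩, -⟩) | ⟨hx, -⟩)
        · exact hZS hx
        · exact hx
        · exact hx
    have h2 : S' = Z ∪ ((S' ∩ F) \ Z) ∪ (S' \ F) := by
      ext x
      constructor
      · intro hx
        by_cases hxF : x ∈ F
        · by_cases hxZ : x ∈ Z
          · exact Or.inl (Or.inl hxZ)
          · exact Or.inl (Or.inr ⟨⟨hx, hxF⟩, hxZ⟩)
        · exact Or.inr ⟨hx, hxF⟩
      · rintro ((hx | ⟨⟨hx, -⟩, -⟩) | ⟨hx, -⟩)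
        · exact hZS' hx
        · exact hx
        · exact hx
    rw [h1, h2, hSS'.1, hSS'.2]
  have himg : (fun S : Set α => ((S ∩ F) \ Z, S \ F)) '' T = A ×ˢ B := by
    ext ⟨Y₁, Y₂⟩
    simp only [Set.mem_image, Set.mem_prod, Prod.mk.injEq]
    constructor
    · rintro ⟨S, ⟨hZS, hSE, hSF, hSD⟩, rfl, rfl⟩
      have hSfin : S.Finite := hE.subset hSE
      refine ⟨⟨?_, ?_⟩, ⟨?_, hSD⟩⟩
      · rw [hPc]
        exact sdiff_subset_sdiff_left inter_subset_right
      · have hZsub : Z ⊆ S ∩ F := subset_inter hZS hZF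
        rw [Set.ncard_sdiff hZsub hZfin, hSF]
        omega
      · rw [hDc]
        exact sdiff_subset_sdiff_left hSE
    · rintro ⟨⟨hY₁, hY₁a⟩, ⟨hY₂, hY₂j⟩⟩
      rw [hPc] at hY₁
      rw [hDc] at hY₂
      have hY₁fin : Y₁.Finite := (hFfin.sdiff).subset hY₁
      have hY₂fin : Y₂.Finite := (hE.sdiff).subset hY₂
      refine ⟨Z ∪ Y₁ ∪ Y₂, ⟨?_, ?_, ?_, ?_⟩, ?_, ?_⟩
      · exact (subset_union_left).trans subset_union_left
      · refine union_subset (union_subset (hZF.trans hF) ((hY₁.trans sdiff_subset).trans hF)) (hY₂.trans sdiff_subset)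
      · have hSF : (Z ∪ Y₁ ∪ Y₂) ∩ F = Z ∪ Y₁ := by
          ext x
          constructor
          · rintro ⟨hx1, hx2⟩
            rcases hx1 with (hx | hx) | hx
            · exact Or.inl hx
            · exact Or.inr hx
            · exact absurd hx2 (hY₂ hx).2
          · rintro (hx | hx)
            · exact ⟨Or.inl (Or.inl hx), hZF hx⟩
            · exact ⟨Or.inl (Or.inr hx), (hY₁ hx).1⟩
        have hdisj : Disjoint Z Y₁ := by
          refine Set.disjoint_left.mpr ?_
          intro x hxZ hxY
          exact (hY₁ hxY).2 hxZ
        rw [hSF, Set.ncard_union_eq hdisj hZfin hY₁fin, hY₁a]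
      · have hSD : (Z ∪ Y₁ ∪ Y₂) \ F = Y₂ := by
          ext x
          constructor
          · rintro ⟨hx1, hx2⟩
            rcases hx1 with (hx | hx) | hx
            · exact absurd (hZF hx) hx2
            · exact absurd (hY₁ hx).1 hx2
            · exact hx
          · intro hx
            exact ⟨Or.inr hx, (hY₂ hx).2⟩
        rw [hSD, hY₂j]
      · -- ((Z ∪ Y₁ ∪ Y₂) ∩ F) ∖ Z = Y₁
        ext x
        constructor
        · rintro ⟨⟨hx1, hx2⟩, hxZ⟩
          rcases hx1 with (hx | hx) | hx
          · exact absurd hx hxZ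
          · exact hx
          · exact absurd hx2 (hY₂ hx).2
        · intro hx
          exact ⟨⟨Or.inl (Or.inr hx), (hY₁ hx).1⟩, (hY₁ hx).2⟩
      · -- (Z ∪ Y₁ ∪ Y₂) ∖ F = Y₂
        ext x
        constructor
        · rintro ⟨hx1, hx2⟩
          rcases hx1 with (hx | hx) | hx
          · exact absurd (hZF hx) hx2
          · exact absurd (hY₁ hx).1 hx2
          · exact hx
        · intro hx
          exact ⟨Or.inr hx, (hY₂ hx).2⟩
  calc T.ncard = ((fun S : Set α => ((S ∩ F) \ Z, S \ F)) '' T).ncard := (hinj.ncard_image).symm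
    _ = (A ×ˢ B).ncard := by rw [himg]
    _ = (F.ncard - Z.ncard).choose a * (E \ F).ncard.choose j := by rw [Set.ncard_prod, hAcard, hBcard]

end PercRepro
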